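import Mathlib

/-!
# Automorphy (same character) and the classical Hecke operators commute with `z ↦ -z̄`

Stub P2b `stub_reflect_automorphy_hecke` for line *Sketch* of the crux
`Summit.Langlands.Langlands.Theses.QuarterDeficit1951.QuarterFingerprintDeficit`, kernel-proved
from Mathlib only.

For `u : ℍ → ℂ` with `u (γ • z) = χ(d_γ) u z` on `Γ₀(1951)` and the reflection `R = J : z ↦ -z̄`:
* `u ∘ R` is automorphic with the SAME character, because `R γ R = [[a,-b],[-c,d]] ∈ Γ₀(1951)`
  has the same lower-right entry `d` and `R(γ z) = (R γ R)(R z)`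
  (`ReflectAutomorphyHeckeAux.exists_reflConj`);
* for `p ∈ {2,3,5,7,11,13}` the crux's Hecke operator
  `T_p u (z) = p^{-1/2} (Σ_{b<p} u((z+b)/p) + χ(p) u(p z))` satisfies `T_p (u ∘ R) = (T_p u) ∘ R`:
  `R((z+b)/p) = (R z - b)/p`, and by the period `1` of `u` (`T ∈ Γ₀(1951)`, `χ(1) = 1`) the
  points `(w - b)/p`, `0 ≤ b < p`, may be replaced by `(w + b')/p` with `b' = 0` for `b = 0` and
  `b' = p - b` otherwise (`ReflectAutomorphyHeckeAux.sum_shift_reflect`); finally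
  `R(p z) = p · R z`.

Only Mathlib is used (`UpperHalfPlane.coe_J_smul`, `UpperHalfPlane.coe_specialLinearGroup_apply`,
`CongruenceSubgroup.Gamma0_mem`, `UpperHalfPlane.ofComplex_apply_of_im_pos`,
`UpperHalfPlane.modular_T_smul`, `Finset.sum_nbij'`).
-/

set_option linter.dupNamespace false

namespace Summit.Langlands.Langlands.Theorems.QuarterFingerprintDeficit

open scoped MatrixGroups ComplexConjugate
open UpperHalfPlane

namespace ReflectAutomorphyHeckeAux

/-- `R(w) = -w̄` on `ℍ`, in terms of `ofComplex`: `J • ofComplex w = ofComplex (-conj w)` for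
`0 < im w`. [folklore] -/
private theorem J_smul_ofComplex_eq (w : ℂ) (hw : 0 < w.im) :
    J • ofComplex w = ofComplex (-conj w) := by
  have h2 : 0 < (-conj w).im := by simpa using hw
  apply UpperHalfPlane.ext
  rw [coe_J_smul, ofComplex_apply_of_im_pos hw, ofComplex_apply_of_im_pos h2, coe_mk, coe_mk]

/-- `T • w = w + 1` on `ℍ`, in terms of `ofComplex`: `T • ofComplex w = ofComplex (w + 1)` for
`0 < im w`. [folklore] -/
private theorem T_smul_ofComplex_eq (w : ℂ) (hw : 0 < w.im) :
    ModularGroup.T • ofComplex w = ofComplex (w + 1) := by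
  have h2 : 0 < (w + 1).im := by simpa using hw
  apply UpperHalfPlane.ext
  rw [modular_T_smul, coe_vadd, ofComplex_apply_of_im_pos hw, ofComplex_apply_of_im_pos h2, coe_mk,
    coe_mk]
  push_cast
  ring

/-- For `γ = [[a,b],[c,d]] ∈ Γ₀(N)`, the conjugate `R γ R = [[a,-b],[-c,d]]` of `γ` by the reflection
`R : z ↦ -z̄` is again in `Γ₀(N)` (determinant `a d - b c = 1`, lower-left entry `-c`), has the
same lower-right entry `d`, and satisfies `R(γ z) = (R γ R)(R z)` on `ℍ`. [folklore] -/
private theorem exists_reflConj {N : ℕ} {γ : SL(2, ℤ)} (hγ : γ ∈ CongruenceSubgroup.Gamma0 N) :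
    ∃ γ' : SL(2, ℤ), γ' ∈ CongruenceSubgroup.Gamma0 N ∧ (γ' 1 1 : ℤ) = γ 1 1 ∧
      ∀ z : ℍ, J • (γ • z) = γ' • (J • z) := by
  have hdet : Matrix.det !![γ 0 0, -(γ 0 1); -(γ 1 0), γ 1 1] = 1 := by
    have h := γ.det_coe
    rw [Matrix.det_fin_two] at h
    rw [Matrix.det_fin_two_of]
    linarith
  refine ⟨⟨_, hdet⟩, ?_, rfl, fun z => ?_⟩
  · rw [CongruenceSubgroup.Gamma0_mem] at hγ ⊢
    change (((-(γ 1 0) : ℤ)) : ZMod N) = 0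
    simp [hγ]
  · apply UpperHalfPlane.ext
    rw [coe_J_smul, coe_specialLinearGroup_apply, coe_specialLinearGroup_apply, coe_J_smul]
    simp only [eq_intCast, Matrix.of_apply, Matrix.cons_val', Matrix.cons_val_zero,
      Matrix.cons_val_one, Matrix.cons_val_fin_one, Matrix.empty_val', map_div₀, map_add, map_mul,
      map_neg, Complex.conj_ofReal]
    rw [← neg_div]
    congr 1 <;> push_cast <;> ring

/-- Reindexing `b ↦ (p - b) mod p` inside a Hecke sum, using the period `1` of `u`:
`Σ_{b<p} u((w - b)/p) = Σ_{b<p} u((w + b)/p)`. [folklore] -/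
private theorem sum_shift_reflect (u : ℍ → ℂ)
    (hper : ∀ w : ℂ, 0 < w.im → u (ofComplex (w + 1)) = u (ofComplex w))
    (w : ℂ) (hw : 0 < w.im) (p : ℕ) (hp : 0 < p) :
    ∑ b ∈ Finset.range p, u (ofComplex ((w - b) / p)) =
      ∑ b ∈ Finset.range p, u (ofComplex ((w + b) / p)) := by
  refine Finset.sum_nbij' (fun b => if b = 0 then 0 else p - b) (fun b => if b = 0 then 0 else p - b)
    ?_ ?_ ?_ ?_ ?_
  · intro b hb
    simp only [Finset.mem_range] at hb ⊢
    split_ifs <;> omega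
  · intro b hb
    simp only [Finset.mem_range] at hb ⊢
    split_ifs <;> omega
  · intro b hb
    simp only [Finset.mem_range] at hb
    by_cases h0 : b = 0
    · simp [h0]
    · have h1 : p - b ≠ 0 := by omega
      simp only [h0, if_false, h1]
      omega
  · intro b hb
    simp only [Finset.mem_range] at hb
    by_cases h0 : b = 0
    · simp [h0]
    · have h1 : p - b ≠ 0 := by omega
      simp only [h0, if_false, h1]
      omega
  · intro b hb
    simp only [Finset.mem_range] at hb
    by_cases h0 : b = 0
    · simp [h0]
    · simp only [h0, if_false]
      have hbp : b ≤ p := hb.le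
      have hpC : (p : ℂ) ≠ 0 := by exact_mod_cast hp.ne'
      have e : (w + ((p - b : ℕ) : ℂ)) / p = (w - b) / p + 1 := by
        rw [Nat.cast_sub hbp]
        field_simp
        ring
      have him : 0 < ((w - b) / p).im := by
        rw [Complex.div_natCast_im]
        simp only [Complex.sub_im, Complex.natCast_im, sub_zero]
        exact div_pos hw (by exact_mod_cast hp)
      rw [e, hper _ him]

end ReflectAutomorphyHeckeAux

open ReflectAutomorphyHeckeAux in
/-- **Stub P2b.** Automorphy with the same character transports under `R : z ↦ -z̄`
(`R = UpperHalfPlane.J`), and the crux's Hecke operators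
`T_p u (z) = p^{-1/2} (Σ_{b<p} u((z+b)/p) + χ(p) u(p z))` for `p ∈ {2,3,5,7,11,13}` commute with `R`:
if `u (γ • z) = χ(d_γ) u z` for all `γ ∈ Γ₀(1951)`, then the same holds for `u ∘ R`, and
`T_p (u ∘ R) z = (T_p u) (R z)`. [folklore] -/
theorem stub_reflect_automorphy_hecke (χ : DirichletCharacter ℂ 1951) (u : UpperHalfPlane → ℂ)
    (haut : ∀ γ : Matrix.SpecialLinearGroup (Fin 2) ℤ, γ ∈ CongruenceSubgroup.Gamma0 1951 →
      ∀ z : UpperHalfPlane, u (γ • z) = χ ((γ 1 1 : ℤ) : ZMod 1951) * u z) :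
    (∀ γ : Matrix.SpecialLinearGroup (Fin 2) ℤ, γ ∈ CongruenceSubgroup.Gamma0 1951 →
      ∀ z : UpperHalfPlane, u (UpperHalfPlane.J • (γ • z)) =
        χ ((γ 1 1 : ℤ) : ZMod 1951) * u (UpperHalfPlane.J • z)) ∧
    ∀ p ∈ ({2, 3, 5, 7, 11, 13} : Finset ℕ), ∀ z : UpperHalfPlane,
      ((Real.sqrt p : ℝ) : ℂ)⁻¹ *
        ((∑ b ∈ Finset.range p,
            u (UpperHalfPlane.J • UpperHalfPlane.ofComplex (((z : ℂ) + b) / p))) +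
          χ (p : ZMod 1951) * u (UpperHalfPlane.J • UpperHalfPlane.ofComplex ((p : ℂ) * z))) =
      ((Real.sqrt p : ℝ) : ℂ)⁻¹ *
        ((∑ b ∈ Finset.range p,
            u (UpperHalfPlane.ofComplex (((↑(UpperHalfPlane.J • z) : ℂ) + b) / p))) +
          χ (p : ZMod 1951) * u (UpperHalfPlane.ofComplex ((p : ℂ) * ↑(UpperHalfPlane.J • z)))) := by
  constructor
  · intro γ hγ z
    obtain ⟨γ', hγ', h11, hJ⟩ := exists_reflConj hγ
    rw [hJ, haut _ hγ', h11]
  · intro p hp z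
    have hp0 : 0 < p := by
      simp only [Finset.mem_insert, Finset.mem_singleton] at hp
      rcases hp with rfl | rfl | rfl | rfl | rfl | rfl <;> norm_num
    have hT1 : ((ModularGroup.T 1 1 : ℤ) : ZMod 1951) = 1 := by simp [ModularGroup.T]
    have hTmem : ModularGroup.T ∈ CongruenceSubgroup.Gamma0 1951 := by
      rw [CongruenceSubgroup.Gamma0_mem]; simp [ModularGroup.T]
    have hper : ∀ w : ℂ, 0 < w.im → u (ofComplex (w + 1)) = u (ofComplex w) := by
      intro w hw
      rw [← T_smul_ofComplex_eq w hw, haut _ hTmem, hT1, map_one, one_mul]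
    have hzim : 0 < (z : ℂ).im := z.im_pos
    have hpR : (0 : ℝ) < p := by exact_mod_cast hp0
    -- the `χ(p) u(p z)` term: `R(p z) = p · R z`
    have h2 : UpperHalfPlane.J • UpperHalfPlane.ofComplex ((p : ℂ) * z) =
        UpperHalfPlane.ofComplex ((p : ℂ) * ↑(UpperHalfPlane.J • z)) := by
      have him : 0 < ((p : ℂ) * (z : ℂ)).im := by
        simp only [Complex.mul_im, Complex.natCast_re, Complex.natCast_im, zero_mul, add_zero]
        exact mul_pos hpR hzim
      rw [J_smul_ofComplex_eq _ him, coe_J_smul]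
      congr 1
      simp [map_mul, map_natCast]
    -- the sum: reflect each point (`R((z+b)/p) = (R z - b)/p`), then shift `b ↦ p - b`
    have h1 : ∀ b ∈ Finset.range p,
        u (UpperHalfPlane.J • UpperHalfPlane.ofComplex (((z : ℂ) + b) / p)) =
        u (UpperHalfPlane.ofComplex (((↑(UpperHalfPlane.J • z) : ℂ) - b) / p)) := by
      intro b _
      have him : 0 < (((z : ℂ) + b) / p).im := by
        rw [Complex.div_natCast_im]
        simp only [Complex.add_im, Complex.natCast_im, add_zero]
        exact div_pos hzim hpR
      rw [J_smul_ofComplex_eq _ him, coe_J_smul]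
      congr 2
      simp only [map_div₀, map_add, map_natCast]
      ring
    have hJim : 0 < ((↑(UpperHalfPlane.J • z) : ℂ)).im := (UpperHalfPlane.J • z).im_pos
    rw [Finset.sum_congr rfl h1, sum_shift_reflect u hper _ hJim p hp0, h2]

end Summit.Langlands.Langlands.Theorems.QuarterFingerprintDeficit
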